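import Summits.CriticalPhenomena.PercolationContinuityZ3.Theorems.Transplant.GrigorchukPowerGreenComparison
import Summits.CriticalPhenomena.PercolationContinuityZ3.Theorems.Transplant.GrigorchukPowerNcHaraSladeBootstrapBasics
import HarnessLib

/-!
# W4 S3b-γ (second file) «ImprovementOfLaceBound»: a lace bound `≤ ε ≤ 1/18` forces `f(k,p) ≤ 1 + 18ε` — the W4 stub S3b′ `stub_fBoot_le_of_laceBound` (skeleton v1.8 :80) AS A TREE THEOREM

Proof file (`--supports stmt-CriticalPhenomena-4575 --as helper`), lane `prim-bschramm`, seat `prim-bschramm-gen-1` gen 13 (GEN pen); item γ of P3-NILPOTENT §39 (39.2),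
second half = (γ3)–(γ5) over α/β/γ₁ (HOLD/GATED on β ACCEPTED + the lead's line — typed ahead, filed only when opened):
* §1 `exists_laceKernel_of_laceBound_lt_one` — extraction: `laceBound k p ≤ ofReal ε`, `ε < 1` ⇒ THE lace kernel `K` (unique by β `IsLaceKernel.unique`) with
  `laceBound = laceNormE K`, `‖K‖₁ ≤ ε` and the weighted bound with constant `ε`;
* §2 (γ3) the scalar lines (`scalar_sign_line`, `inv_one_sub_le`) and **`inner_XOp_ge_green`**: `⟪η, T⁻¹ η⟫ ≥ (1 + 18ε)⁻¹ ⟪η, (1 − P_L) η⟫` (β (β9) + the sign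
  split on `4kp − a⁻²ε − 1/(2C′)` with `κ ≤ 2‖η‖²` — laziness used exactly once, SN3);
* §3 (γ4) **`oirbAt_of_laceKernel`**: `OIRBAt k p (ofReal (1 + 18ε))` (for `θ ∈ (0,1)`: `Y_θ = ((1−θ)/C′)(1 − P_L) + θ‖T‖⁻¹ ≼ T⁻¹`, γ₁ (γ1) + (γ2), then `θ ↓ 0`)
  and `fOne_le_of_laceKernel` (`4kp = a⁻¹ − χ⁻¹ ≤ (1 − ε)⁻¹ ≤ 1 + 18ε`);
* §4 (γ5) **`stub_fBoot_le_of_laceBound (k) (hk : 1 ≤ k) (t) (ht : t ∈ Ioo 0 (pcR k)) (ε) (hε0 : 0 ≤ ε) (hε : ε ≤ 1/18) (hL : laceBound k (toI t) ≤ ofReal ε) :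
  fBoot k t ≤ 1 + 18 * ε`** — the registered signature LITERALLY (W4 skeleton of record v1.8 209514dd :80; critic V8-2 diff-read).
MUST-NOT: nothing here asserts that a lace kernel exists on any `Cay(𝔊^k)` or that `laceBound` is ever finite (that is S3a′ `stub_laceBound_small`, the research stub,
OPEN); nothing about `θ(p_c)`, `gkCay_conj4`, the residue node or `…endState`.  builds on p205010 (kernel theorem, internal audit signed; external expert review pending) —
nothing here uses p205010.  Def-free; no instance, no notation, no sorry.
[cite: HeydenreichVanDerHofstad2017, Lemma 8.12 ((8.4.14)–(8.4.29)), §8.4 (the improvement of the bootstrap bounds)] [cite: HaraSlade1990, §4]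
-/

noncomputable section

namespace Summit.CriticalPhenomena.PercolationContinuityZ3.Theorems.Transplant

namespace Grigorchuk

namespace NcHaraSlade

open Set SimpleGraph Literature.Probability.Percolation Literature.Barriers.CriticalPhenomena
open scoped ENNReal Classical InnerProductSpace

variable {k : ℕ}

/-! ## §1 Extraction of THE lace kernel from a lace bound `< 1` -/

/-- The real ℓ¹ norm of a lace kernel is below its lace norm: `ofReal (Σ |K|) ≤ laceNormE k K`. [folklore] -/
theorem ofReal_tsum_abs_le_laceNormE {p : unitInterval} {K : GPow k → ℝ} (hK : IsLaceKernel k p K) :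
    ENNReal.ofReal (∑' x, |K x|) ≤ laceNormE k K := by
  rw [ENNReal.ofReal_tsum_of_nonneg (fun x => abs_nonneg (K x)) hK.summable_abs]
  exact tsum_ofReal_abs_le_laceNormE K

/-- **EXTRACTION**: if `laceBound k p ≤ ofReal ε` with `0 ≤ ε < 1` (and `p < p_c`), then there is a lace kernel `K` — THE lace kernel, by β `IsLaceKernel.unique` —
with `laceBound k p = laceNormE k K ≤ ofReal ε`, `Σ |K| ≤ ε` (`< 1`), and the weighted bound `Σ_x |K x| ω_ξ(x) ≤ ε κ₀(ξ)` for every finitely supported `ξ` with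
`κ₀(ξ) > 0`.  (Existence is the HYPOTHESIS `laceBound ≤ ofReal ε`; nothing asserts it.) [cite: HeydenreichVanDerHofstad2017, Prop. 8.3, Lemma 8.11] -/
theorem exists_laceKernel_of_laceBound_lt_one {p : unitInterval} (hp : (p : ℝ) < pcR k) {ε : ℝ} (hε0 : 0 ≤ ε) (hε1 : ε < 1)
    (hL : laceBound k p ≤ ENNReal.ofReal ε) :
    ∃ K : GPow k → ℝ, IsLaceKernel k p K ∧ laceBound k p = laceNormE k K ∧ laceNormE k K ≤ ENNReal.ofReal ε ∧ ∑' x, |K x| ≤ ε ∧ ∑' x, |K x| < 1 ∧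
      ∀ ξ : GPow k →₀ ℝ, 0 < kappa0 k ξ → ∑' x, |K x| * omegaV ξ x ≤ ε * kappa0 k ξ := by
  have hlt : laceBound k p < 1 := by
    refine hL.trans_lt ?_
    rw [← ENNReal.ofReal_one]
    exact (ENNReal.ofReal_lt_ofReal_iff zero_lt_one).2 hε1
  have hlt' := hlt
  unfold laceBound at hlt'
  obtain ⟨K, hK'⟩ := iInf_lt_iff.1 hlt'
  obtain ⟨hK, hKlt⟩ := iInf_lt_iff.1 hK'
  have hK1 : ∑' x, |K x| < 1 := by
    have h := (ofReal_tsum_abs_le_laceNormE hK).trans_lt hKlt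
    rw [← ENNReal.ofReal_one] at h
    exact (ENNReal.ofReal_lt_ofReal_iff zero_lt_one).1 h
  have heq : laceBound k p = laceNormE k K := by
    refine le_antisymm (laceBound_le hK) ?_
    unfold laceBound
    refine le_iInf₂ fun K' hK' => ?_
    rw [IsLaceKernel.unique hK hK' hp hK1]
  have hKε : laceNormE k K ≤ ENNReal.ofReal ε := heq ▸ hL
  refine ⟨K, hK, heq, hKε, ?_, hK1, fun ξ hξ => ?_⟩
  · exact (ENNReal.ofReal_le_ofReal_iff hε0).1 ((ofReal_tsum_abs_le_laceNormE hK).trans hKε)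
  · have h1 : ENNReal.ofReal ((∑' x, |K x| * omegaV ξ x) / kappa0 k ξ) ≤ laceNormE k K :=
      le_sup_of_le_right (le_iSup₂_of_le ξ hξ le_rfl)
    have h2 := (ENNReal.ofReal_le_ofReal_iff hε0).1 (h1.trans hKε)
    rwa [div_le_iff₀ hξ] at h2

/-! ## §2 (γ3) The scalar lines and `T⁻¹ ≽ C′⁻¹ (1 − P_L)` -/

/-- **The sign line** (critic's kernel-checked template, re-derived): for `1 − ε ≤ a ≤ 1 + ε`, `0 ≤ ε ≤ 1/18`: `a⁻¹ − 2εa⁻² ≥ (1 + 18ε)⁻¹`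
(`q(a) = a² − (1+18ε)a + 2ε(1+18ε) ≤ (a − (1−ε))(a − (1+ε)) − 15ε + 19ε² ≤ 0`). [cite: HeydenreichVanDerHofstad2017, Lemma 8.12 ((8.4.22)–(8.4.29), the choice of constants)] -/
theorem scalar_sign_line {a ε : ℝ} (hε0 : 0 ≤ ε) (hε : ε ≤ 1 / 18) (ha1 : 1 - ε ≤ a) (ha2 : a ≤ 1 + ε) :
    (1 + 18 * ε)⁻¹ ≤ a⁻¹ - 2 * ε * a⁻¹ ^ 2 := by
  have ha : 0 < a := by linarith
  have hC : 0 < 1 + 18 * ε := by linarith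
  have hq : a ^ 2 - (1 + 18 * ε) * a + 2 * ε * (1 + 18 * ε) ≤ 0 := by
    nlinarith [mul_nonneg (sub_nonneg.2 ha1) (sub_nonneg.2 ha2), mul_nonneg hε0 (by linarith : (0 : ℝ) ≤ 15 - 19 * ε),
      mul_nonneg (by linarith : (0 : ℝ) ≤ 1 - 18 * ε) (sub_nonneg.2 ha2)]
  rw [show a⁻¹ - 2 * ε * a⁻¹ ^ 2 = (a - 2 * ε) / a ^ 2 by field_simp, le_div_iff₀ (by positivity), show (1 + 18 * ε)⁻¹ * a ^ 2 = a ^ 2 / (1 + 18 * ε) by ring,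
    div_le_iff₀ hC]
  nlinarith

/-- `(1 − ε)⁻¹ ≤ 1 + 18ε` for `0 ≤ ε ≤ 1/18`. [folklore] -/
theorem inv_one_sub_le {ε : ℝ} (hε0 : 0 ≤ ε) (hε : ε ≤ 1 / 18) : (1 - ε)⁻¹ ≤ 1 + 18 * ε := by
  rw [← one_div, div_le_iff₀ (by linarith)]
  nlinarith

/-- `κ(η) ≤ 2‖η‖²` (`k ≥ 1`). [folklore] -/
theorem kappaL2_le (hk : 1 ≤ k) (η : lp (fun _ : GPow k => ℝ) 2) : kappaL2 k η ≤ 2 * ‖η‖ ^ 2 := by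
  have h1 : (1 : ℝ) ≤ k := by exact_mod_cast hk
  rw [kappaL2_eq_sum hk]
  calc 1 / (4 * (k : ℝ)) * ∑ s ∈ gkGens k, omegaL2 η s ≤ 1 / (4 * (k : ℝ)) * ∑ _s ∈ gkGens k, 2 * ‖η‖ ^ 2 :=
        mul_le_mul_of_nonneg_left (Finset.sum_le_sum fun s _ => omegaL2_le η s) (by positivity)
    _ = 2 * ‖η‖ ^ 2 := by rw [Finset.sum_const, card_gkGens, nsmul_eq_mul]; push_cast; field_simp

/-- `⟪η, (1 − P_L) η⟫ = κ(η)/2` (`1 − P_L = ½(1 − P)`). [cite: HeydenreichVanDerHofstad2017, §5.2 (laziness; SN3)] -/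
theorem inner_one_sub_lazyOp (η : lp (fun _ : GPow k => ℝ) 2) :
    ⟪η, ((1 : lp (fun _ : GPow k => ℝ) 2 →L[ℝ] lp (fun _ : GPow k => ℝ) 2) - lazyOp k) η⟫_ℝ = kappaL2 k η / 2 := by
  unfold kappaL2
  rw [sub_apply, one_apply_eq_self, inner_sub_right, real_inner_self_eq_norm_sq, inner_lazyOp_eq, sub_apply, one_apply_eq_self, inner_sub_right,
    real_inner_self_eq_norm_sq]
  ring

/-- `1 − ε ≤ a = 1 + Σ K ≤ 1 + ε` when `Σ |K| ≤ ε`. [folklore] -/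
theorem psiSum_mem {K : GPow k → ℝ} (hK : Summable fun x => |K x|) {ε : ℝ} (hKε : ∑' x, |K x| ≤ ε) :
    1 - ε ≤ 1 + ∑' x, K x ∧ 1 + ∑' x, K x ≤ 1 + ε := by
  have hn : Summable fun x => ‖K x‖ := by simpa only [Real.norm_eq_abs] using hK
  have h : |∑' x, K x| ≤ ∑' x, |K x| := by
    have h := norm_tsum_le_tsum_norm hn
    simpa only [Real.norm_eq_abs] using h
  obtain ⟨h1, h2⟩ := abs_le.1 h
  exact ⟨by linarith, by linarith⟩

/-- **`⟪η, T⁻¹ η⟫ ≥ (1 + 18ε)⁻¹ ⟪η, (1 − P_L) η⟫`** for THE lace kernel with `‖K‖₁ ≤ ε ≤ 1/18` and weighted constant `ε` (`k ≥ 1`, `p < p_c`): β's resolvent bound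
`χ⁻¹‖η‖² + (4kp − a⁻²ε)κ` plus the sign split — if `4kp − a⁻²ε − 1/(2C′) < 0` use `κ ≤ 2‖η‖²` and `χ⁻¹ = a⁻¹ − 4kp`, reducing to `scalar_sign_line`.
[cite: HeydenreichVanDerHofstad2017, Lemma 8.12 ((8.4.22)–(8.4.29))] -/
theorem inner_XOp_ge_green (hk : 1 ≤ k) {p : unitInterval} {K : GPow k → ℝ} (hK : IsLaceKernel k p K) (hp : (p : ℝ) < pcR k) {ε : ℝ} (hε0 : 0 ≤ ε)
    (hε : ε ≤ 1 / 18) (hKε : ∑' x, |K x| ≤ ε) (hB : ∀ ξ : GPow k →₀ ℝ, 0 < kappa0 k ξ → ∑' x, |K x| * omegaV ξ x ≤ ε * kappa0 k ξ)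
    (η : lp (fun _ : GPow k => ℝ) 2) :
    (1 + 18 * ε)⁻¹ * ⟪η, ((1 : lp (fun _ : GPow k => ℝ) 2 →L[ℝ] lp (fun _ : GPow k => ℝ) 2) - lazyOp k) η⟫_ℝ ≤ ⟪η, XOp k p K η⟫_ℝ := by
  have hK1 : ∑' x, |K x| < 1 := lt_of_le_of_lt hKε (by linarith)
  have hres := inner_XOp_ge_resolvent hk hK hp hK1 hB η
  obtain ⟨hapos, hinvχ⟩ := inv_tsum_tauFun_eq hK hp
  obtain ⟨ha1, ha2⟩ := psiSum_mem hK.summable_abs hKε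
  set a : ℝ := 1 + ∑' x, K x with ha
  set χ : ℝ := ∑' g, tauFun k p g with hχ
  set n : ℝ := ‖η‖ ^ 2 with hn
  set κ : ℝ := kappaL2 k η with hκ
  have hχ1 : 1 ≤ χ := one_le_tsum_tauFun hp
  have hχinv : 0 < χ⁻¹ := inv_pos.2 (by linarith)
  have hκ0 : 0 ≤ κ := kappaL2_nonneg hk η
  have hκ2 : κ ≤ 2 * n := kappaL2_le hk η
  have h4kp : 0 ≤ 4 * k * (p : ℝ) := by have := p.2.1; positivity
  have hsign := scalar_sign_line hε0 hε ha1 ha2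
  have hC : 0 < 1 + 18 * ε := by linarith
  rw [inner_one_sub_lazyOp]
  -- `hres : χ⁻¹ n + (4kp − a⁻²ε) κ ≤ ⟪η, Xη⟫`, `hinvχ : χ⁻¹ = a⁻¹ − 4kp`
  by_cases hcase : (1 + 18 * ε)⁻¹ / 2 ≤ 4 * k * (p : ℝ) - a⁻¹ ^ 2 * ε
  · -- nonnegative coefficient on `κ`
    have : (1 + 18 * ε)⁻¹ * (κ / 2) ≤ (4 * k * (p : ℝ) - a⁻¹ ^ 2 * ε) * κ := by nlinarith
    nlinarith [mul_nonneg hχinv.le (sq_nonneg ‖η‖)]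
  · push Not at hcase
    -- negative coefficient: use `κ ≤ 2n`
    have h1 : (4 * k * (p : ℝ) - a⁻¹ ^ 2 * ε - (1 + 18 * ε)⁻¹ / 2) * κ ≥ (4 * k * (p : ℝ) - a⁻¹ ^ 2 * ε - (1 + 18 * ε)⁻¹ / 2) * (2 * n) :=
      mul_le_mul_of_nonpos_left hκ2 (by linarith)
    have h2 : 0 ≤ n * (a⁻¹ - 2 * ε * a⁻¹ ^ 2 - (1 + 18 * ε)⁻¹) := mul_nonneg (sq_nonneg _) (by linarith)
    rw [hinvχ] at hres
    nlinarith [mul_nonneg (sq_nonneg ‖η‖) h4kp]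

/-! ## §3 (γ4) The operator infrared bound from a lace kernel -/

/-- `X = T⁻¹` is a unit with `Ring.inverse X = T`. [folklore] -/
theorem inverse_XOp {p : unitInterval} {K : GPow k → ℝ} (hK : IsLaceKernel k p K) (hp : (p : ℝ) < pcR k) (hK1 : ∑' x, |K x| < 1) :
    IsUnit (XOp k p K) ∧ Ring.inverse (XOp k p K) = twoPointOp k p := by
  have h1 := XOp_mul_twoPointOp hK hp hK1
  have h2 := twoPointOp_mul_XOp hK hp hK1
  have hu : IsUnit (XOp k p K) := isUnit_iff_exists.2 ⟨twoPointOp k p, h1, h2⟩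
  refine ⟨hu, ?_⟩
  calc Ring.inverse (XOp k p K) = Ring.inverse (XOp k p K) * (XOp k p K * twoPointOp k p) := by rw [h1, mul_one]
    _ = (Ring.inverse (XOp k p K) * XOp k p K) * twoPointOp k p := (mul_assoc _ _ _).symm
    _ = twoPointOp k p := by rw [Ring.inverse_mul_cancel _ hu, one_mul]

/-- `‖T‖ > 0` (`(T δ_1)(1) = τ(1) = 1`). [folklore] -/
theorem norm_twoPointOp_pos {p : unitInterval} (hp : (p : ℝ) < pcR k) : 0 < ‖twoPointOp k p‖ := by
  have h1 : twoPointOp k p (lp.single 2 (1 : GPow k) (1 : ℝ)) 1 = 1 := by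
    rw [twoPointOp, kernelOp_single_apply (summable_abs_tauFun hp), inv_one, one_mul, tauFun_one]
  have hne : twoPointOp k p ≠ 0 := by
    intro h0
    rw [h0] at h1
    simp at h1
  exact norm_pos_iff.2 hne

/-- **(γ4) THE KERNEL-LEVEL THEOREM**: a lace kernel at `p < p_c` with `‖K‖₁ ≤ ε ≤ 1/18` and weighted constant `ε` gives the operator infrared bound
`OIRBAt k p (ofReal (1 + 18ε))` (`k ≥ 1`): for `θ ∈ (0,1)`, `Y_θ = ((1−θ)/C′)(1 − P_L) + θ‖T‖⁻¹ ≼ T⁻¹` (§2 + β `inner_XOp_ge`), so by γ₁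
`⟪f, Tf⟫ ≤ ⟪f, Y_θ⁻¹ f⟫ ≤ (C′/(1−θ)) · 𝒢_L(f)`, then `θ ↓ 0`. [cite: HeydenreichVanDerHofstad2017, Lemma 8.12] -/
theorem oirbAt_of_laceKernel (hk : 1 ≤ k) {p : unitInterval} {K : GPow k → ℝ} (hK : IsLaceKernel k p K) (hp : (p : ℝ) < pcR k) {ε : ℝ} (hε0 : 0 ≤ ε)
    (hε : ε ≤ 1 / 18) (hKε : ∑' x, |K x| ≤ ε) (hB : ∀ ξ : GPow k →₀ ℝ, 0 < kappa0 k ξ → ∑' x, |K x| * omegaV ξ x ≤ ε * kappa0 k ξ) :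
    OIRBAt k p (ENNReal.ofReal (1 + 18 * ε)) := by
  intro f
  have hK1 : ∑' x, |K x| < 1 := lt_of_le_of_lt hKε (by linarith)
  set C : ℝ := 1 + 18 * ε with hCdef
  have hC : 0 < C := by rw [hCdef]; linarith
  obtain ⟨huX, hinvX⟩ := inverse_XOp hK hp hK1
  have hT0 := norm_twoPointOp_pos (k := k) hp
  set η := toL2 f with hη
  refine le_mul_of_forall_lt_one hC fun θ hθ0 hθ1 => ?_
  set c : ℝ := (1 - θ) / C with hc
  set m : ℝ := θ * ‖twoPointOp k p‖⁻¹ with hm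
  have hc0 : 0 < c := div_pos (by linarith) hC
  have hm0 : 0 < m := mul_pos hθ0 (inv_pos.2 hT0)
  -- `Y_θ ≼ X`
  have hle : ∀ ζ : lp (fun _ : GPow k => ℝ) 2,
      ⟪ζ, ((c + m) • (1 : lp (fun _ : GPow k => ℝ) 2 →L[ℝ] lp (fun _ : GPow k => ℝ) 2) - c • lazyOp k) ζ⟫_ℝ ≤ ⟪ζ, XOp k p K ζ⟫_ℝ := by
    intro ζ
    have h1 := inner_XOp_ge_green hk hK hp hε0 hε hKε hB ζ
    have h2 := inner_XOp_ge hK hp hK1 ζ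
    have hY : ⟪ζ, ((c + m) • (1 : lp (fun _ : GPow k => ℝ) 2 →L[ℝ] lp (fun _ : GPow k => ℝ) 2) - c • lazyOp k) ζ⟫_ℝ =
        c * ⟪ζ, ((1 : lp (fun _ : GPow k => ℝ) 2 →L[ℝ] lp (fun _ : GPow k => ℝ) 2) - lazyOp k) ζ⟫_ℝ + m * ‖ζ‖ ^ 2 := by
      rw [inner_greenReg_eq, sub_apply, one_apply_eq_self, inner_sub_right, real_inner_self_eq_norm_sq]; ring
    rw [hY, hc, hm]
    have h1' : (1 - θ) / C * ⟪ζ, ((1 : lp (fun _ : GPow k => ℝ) 2 →L[ℝ] lp (fun _ : GPow k => ℝ) 2) - lazyOp k) ζ⟫_ℝ ≤ (1 - θ) * ⟪ζ, XOp k p K ζ⟫_ℝ := by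
      have := mul_le_mul_of_nonneg_left h1 (by linarith : (0 : ℝ) ≤ 1 - θ)
      calc (1 - θ) / C * ⟪ζ, ((1 : lp (fun _ : GPow k => ℝ) 2 →L[ℝ] lp (fun _ : GPow k => ℝ) 2) - lazyOp k) ζ⟫_ℝ
          = (1 - θ) * (C⁻¹ * ⟪ζ, ((1 : lp (fun _ : GPow k => ℝ) 2 →L[ℝ] lp (fun _ : GPow k => ℝ) 2) - lazyOp k) ζ⟫_ℝ) := by rw [hCdef]; ring
        _ ≤ (1 - θ) * ⟪ζ, XOp k p K ζ⟫_ℝ := this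
    have h2' : θ * ‖twoPointOp k p‖⁻¹ * ‖ζ‖ ^ 2 ≤ θ * ⟪ζ, XOp k p K ζ⟫_ℝ := by
      have := mul_le_mul_of_nonneg_left h2 hθ0.le
      linarith [this]
    linarith
  -- γ₁: `⟪η, X⁻¹ η⟫ ≤ ⟪η, Y⁻¹ η⟫`, `X⁻¹ = T`
  have hcomp := inner_inverse_le_of_forms_le _ _ (isUnit_greenReg hk hc0 hm0) huX (adjoint_greenReg c m)
    (fun v => (mul_nonneg hm0.le (sq_nonneg ‖v‖)).trans (inner_greenReg_ge hk hc0.le v)) hle η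
  rw [hinvX] at hcomp
  have hgreen := ofReal_inner_greenRegInv_le hk hc0 hm0 f
  calc ENNReal.ofReal (twoPointForm (gkCay k) p f) = ENNReal.ofReal ⟪η, twoPointOp k p η⟫_ℝ := by rw [hη, inner_toL2_twoPointOp hp]
    _ ≤ ENNReal.ofReal ⟪η, Ring.inverse ((c + m) • (1 : lp (fun _ : GPow k => ℝ) 2 →L[ℝ] lp (fun _ : GPow k => ℝ) 2) - c • lazyOp k) η⟫_ℝ :=
        ENNReal.ofReal_le_ofReal hcomp
    _ ≤ ENNReal.ofReal c⁻¹ * greenForm (gkCay k) f := hgreen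
    _ = ENNReal.ofReal (C / (1 - θ)) * greenForm (gkCay k) f := by rw [hc, inv_div]

/-- **`f₁ = 4kp ≤ 1 + 18ε`** for a lace kernel with `‖K‖₁ ≤ ε ≤ 1/18` (`4kp = a⁻¹ − χ⁻¹ ≤ a⁻¹ ≤ (1 − ε)⁻¹`). [cite: HeydenreichVanDerHofstad2017, Lemma 8.12 ((8.4.15))] -/
theorem fOne_le_of_laceKernel {p : unitInterval} {K : GPow k → ℝ} (hK : IsLaceKernel k p K) (hp : (p : ℝ) < pcR k) {ε : ℝ} (hε0 : 0 ≤ ε) (hε : ε ≤ 1 / 18)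
    (hKε : ∑' x, |K x| ≤ ε) : 4 * (k : ℝ) * (p : ℝ) ≤ 1 + 18 * ε := by
  obtain ⟨hapos, hinvχ⟩ := inv_tsum_tauFun_eq hK hp
  obtain ⟨ha1, ha2⟩ := psiSum_mem hK.summable_abs hKε
  have hχinv : 0 < (∑' g, tauFun k p g)⁻¹ := inv_pos.2 (by linarith [one_le_tsum_tauFun (k := k) hp])
  have h1 : 4 * (k : ℝ) * (p : ℝ) ≤ (1 + ∑' x, K x)⁻¹ := by linarith
  have h2 : (1 + ∑' x, K x)⁻¹ ≤ (1 - ε)⁻¹ := inv_anti₀ (by linarith) ha1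
  exact h1.trans (h2.trans (inv_one_sub_le hε0 hε))

/-! ## §4 (γ5) THE STUB S3b′ LITERALLY -/

/-- **W4 stub S3b′ `stub_fBoot_le_of_laceBound` — PROVED** (the signature of the W4 skeleton of record v1.8 209514dd :80, byte for byte): for `k ≥ 1`,
`t ∈ (0, p_c)` and `0 ≤ ε ≤ 1/18`, a lace bound `laceBound k (toI t) ≤ ofReal ε` forces `f(k,t) ≤ 1 + 18ε` — `f₁ = 4kt` by the trivial character (β (β6)),
`f₂ ≤ 1 + 18ε` by the operator infrared bound `oirbAt_of_laceKernel` (`fTwoE` is an infimum over admissible constants).  The hypothesis `laceBound ≤ ofReal ε`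
is S3a′'s OUTPUT, NOT proved anywhere; this file only proves the implication. [cite: HeydenreichVanDerHofstad2017, Lemma 8.11–8.12, §8.4] -/
theorem stub_fBoot_le_of_laceBound (k : ℕ) (hk : 1 ≤ k) (t : ℝ) (ht : t ∈ Ioo 0 (pcR k)) (ε : ℝ) (hε0 : 0 ≤ ε) (hε : ε ≤ 1 / 18)
    (hL : laceBound k (toI t) ≤ ENNReal.ofReal ε) : fBoot k t ≤ 1 + 18 * ε := by
  have hpt : ((toI t : unitInterval) : ℝ) = t := coe_toI_of_mem k ⟨ht.1.le, ht.2⟩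
  have hp : ((toI t : unitInterval) : ℝ) < pcR k := by rw [hpt]; exact ht.2
  obtain ⟨K, hK, -, -, hKε, -, hB⟩ := exists_laceKernel_of_laceBound_lt_one hp hε0 (by linarith) hL
  have hC0 : (0 : ℝ) ≤ 1 + 18 * ε := by linarith
  -- `f₁`
  have h1 : 4 * (k : ℝ) * t ≤ 1 + 18 * ε := by
    have h := fOne_le_of_laceKernel hK hp hε0 hε hKε
    rwa [hpt] at h
  -- `f₂`
  have hO := oirbAt_of_laceKernel hk hK hp hε0 hε hKε hB
  have h2E : fTwoE k (toI t) ≤ ENNReal.ofReal (1 + 18 * ε) := iInf₂_le (ENNReal.ofReal (1 + 18 * ε)) hO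
  have h2 : (fTwoE k (toI t)).toReal ≤ 1 + 18 * ε := ENNReal.toReal_le_of_le_ofReal hC0 h2E
  rw [fBoot_apply]
  exact max_le h1 h2

end NcHaraSlade

end Grigorchuk

end Summit.CriticalPhenomena.PercolationContinuityZ3.Theorems.Transplant

end
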